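import Mathlib
import Literature.Analysis.TotalPositivity.MultiplyPositiveProofs
import Literature.LinearAlgebra.Matrix.GramDeterminantKernel
import Summits.ValiantsHypothesis.ValiantsHypothesis.Theorems.LacunarySymmetroidMatrixDescartesStubDetCurve
import HarnessLib

/-!
# Crux `MatrixDescartes` (stmt-ValiantsHypothesis-18050, the summit's V1), line
# `Cruxes/MatrixDescartes/Lines/lorentzian_shadow.lean`, toward the KNOWN stub `stub_detLorentzian : DetLorentzian`
# — the linear-algebra half: clauses (a) and (b) of `IsLorentzianArray m K (detArray m K A)`

HONEST FRAMING.  Helper lemmas (`--supports stmt-ValiantsHypothesis-18050 --as helper`; merged desk RULING #82,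
2026-08-28) on a registered ALTERNATIVE line of V1.  `stub_detLorentzian` itself (clauses (c) M-convex support and
(d) the Hessian condition = Gårding hyperbolicity / Brändén–Huh "stable ⇒ Lorentzian") is NOT proved here and stays
the residual; the law stubs `stub_lorentzianDescartes` / `stub_bmd`, the crux `MatrixDescartes`, Conjecture B and
`VP ≠ VNP` are all OPEN; nothing here bears on them.  0 definitions / 0 named facts.

The line's local vocabulary (`detArray m K A α := coeff (equivFunOnFinite.symm α) (det Σ_l X_l • (A_l).map C)`,
`layer m K := (piFinset fun _ => range (m+1)).filter (Σ α = m)`) is UNFOLDED to Mathlib terms (the line file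
carries `sorry`s and is not importable); the statements agree definitionally, so the line can use them by `exact`.

* `coeff_det_pencil_nonneg` / **`detArray_nonneg_of_posSemidef`** — clause (a): for `A_l ⪰ 0` every
  coefficient of `det Σ_l X_l A_l` is `≥ 0` [cite: BorceaBranden2009, Prop. 2.4 (nonnegative coefficients)].
  Proof: `A_l = B_lᵀ B_l` (`Literature.LinearAlgebra.Matrix.exists_eq_conjTranspose_mul_self_of_posSemidef`);
  with the stacked `Bst : (K·m) × m`, `Σ_l X_l A_l = Bstᵀ · diag(X_{l(r)}) · Bst` (`pencil_eq_gram`); the tree's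
  Cauchy–Binet formula `Literature.Analysis.TotalPositivity.det_mul_eq_sum_strictMono` expands the determinant as
  `Σ_t C (det Bst_t)² · ∏_i X_{l(t i)}`, and each term has nonnegative coefficients (`prod_X_eq_monomial`).
* **`detArray_eq_zero_of_not_mem_layer`** — clause (b): `det Σ_l X_l A_l` is homogeneous of degree `m`
  (val-lit-p4 g10's `DetCurve.det_genericPencil_isHomogeneous`, `…StubDetCurve.lean`, imported by name), so its
  coefficient array lives on `Δ(m,K)` (for any real `A_l`).
-/

set_option linter.dupNamespace false
set_option autoImplicit false

noncomputable section

namespace Summit.ValiantsHypothesis.ValiantsHypothesis.Theorems.LacunarySymmetroidMatrixDescartes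

namespace DetLorentzian

open Matrix Finset MvPolynomial

/-- A product of variables is the monomial of the sum of their exponent vectors. [folklore] -/
theorem prod_X_eq_monomial {σ : Type*} {k : ℕ} (g : Fin k → σ) :
    (∏ i, (X (g i) : MvPolynomial σ ℝ)) = monomial (∑ i, Finsupp.single (g i) 1) 1 := by
  classical
  have key : ∀ s : Finset (Fin k),
      ∏ i ∈ s, (X (g i) : MvPolynomial σ ℝ) = monomial (∑ i ∈ s, Finsupp.single (g i) 1) 1 := by
    intro s
    induction s using Finset.induction_on with
    | empty => rw [prod_empty, sum_empty, monomial_zero', C_1]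
    | insert i s hi ih =>
      rw [prod_insert hi, sum_insert hi, ih, ← pow_one (X (g i)), X_pow_eq_monomial, monomial_mul,
        one_mul]
  exact key univ

/-- The coefficient of a monomial in `C c² · ∏_i X_{g i}` is nonnegative. [folklore] -/
theorem coeff_C_mul_self_mul_prod_X_nonneg {σ : Type*} {k : ℕ} (g : Fin k → σ) (c : ℝ)
    (d : σ →₀ ℕ) : 0 ≤ coeff d (C (c * c) * ∏ i, (X (g i) : MvPolynomial σ ℝ)) := by
  classical
  rw [prod_X_eq_monomial, coeff_C_mul, coeff_monomial]
  split_ifs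
  · rw [mul_one]; exact mul_self_nonneg c
  · rw [mul_zero]

/-- **Gram form of a PSD pencil.**  If `A_l = B_lᵀ B_l` for every `l`, then, with the stacked real matrix
`Bst r j = B_{l(r)} i(r) j` (rows `r ↔ (l(r), i(r))` through `finProdFinEquiv : Fin K × Fin m ≃ Fin (K·m)`), the
linear pencil `Σ_l X_l • A_l` is `Bstᵀ · diag(X_{l(r)}) · Bst` over `ℝ[X_1, …, X_K]`. [folklore] -/
theorem pencil_eq_gram {m K : ℕ} (A B : Fin K → Matrix (Fin m) (Fin m) ℝ) (hB : ∀ l, A l = (B l)ᵀ * B l)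
    (Bst : Matrix (Fin (K * m)) (Fin m) ℝ)
    (hBst : ∀ r j, Bst r j = B (finProdFinEquiv.symm r).1 (finProdFinEquiv.symm r).2 j) :
    (∑ l, (X l : MvPolynomial (Fin K) ℝ) • (A l).map C) =
      ((Bst.map C)ᵀ : Matrix (Fin m) (Fin (K * m)) (MvPolynomial (Fin K) ℝ)) *
        ((diagonal fun r : Fin (K * m) => (X (finProdFinEquiv.symm r).1 : MvPolynomial (Fin K) ℝ)) *
          (Bst.map C : Matrix (Fin (K * m)) (Fin m) (MvPolynomial (Fin K) ℝ))) := by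
  refine Matrix.ext fun j j' => ?_
  rw [Matrix.mul_apply]
  simp only [Matrix.sum_apply, Matrix.smul_apply, Matrix.map_apply, smul_eq_mul, Matrix.transpose_apply,
    diagonal_mul]
  rw [← finProdFinEquiv.sum_comp]
  simp only [hBst, Equiv.symm_apply_apply, Fintype.sum_prod_type]
  refine Finset.sum_congr rfl fun l _ => ?_
  rw [hB l, Matrix.mul_apply, map_sum, Finset.mul_sum]
  refine Finset.sum_congr rfl fun i _ => ?_
  rw [Matrix.transpose_apply, map_mul]
  ring

/-- **The coefficients of `det Σ_l X_l A_l` are nonnegative when every `A_l` is positive semidefinite**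
(Borcea–Brändén 2009, Prop. 2.4, the "nonnegative coefficients" half; proof: `A_l = B_lᵀ B_l`, Cauchy–Binet for
`Bstᵀ · (diag(X) Bst)` makes every coefficient a sum of squares of maximal minors of the stacked `Bst`).
[cite: BorceaBranden2009, Prop. 2.4] -/
theorem coeff_det_pencil_nonneg {m K : ℕ} (A : Fin K → Matrix (Fin m) (Fin m) ℝ)
    (hA : ∀ l, (A l).PosSemidef) (d : Fin K →₀ ℕ) :
    0 ≤ coeff d (Matrix.det (∑ l, (X l : MvPolynomial (Fin K) ℝ) • (A l).map C)) := by
  classical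
  -- Gram factorisation of every `A_l`
  have hB : ∀ l, ∃ B : Matrix (Fin m) (Fin m) ℝ, A l = Bᵀ * B := by
    intro l
    obtain ⟨R, hR⟩ := Literature.LinearAlgebra.Matrix.exists_eq_conjTranspose_mul_self_of_posSemidef (hA l)
    exact ⟨R, by rw [hR, conjTranspose_eq_transpose_of_trivial]⟩
  choose B hB using hB
  set Bst : Matrix (Fin (K * m)) (Fin m) ℝ :=
    Matrix.of fun r j => B (finProdFinEquiv.symm r).1 (finProdFinEquiv.symm r).2 j with hBst
  rw [pencil_eq_gram A B hB Bst (fun r j => rfl)]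
  set N : Matrix (Fin (K * m)) (Fin m) (MvPolynomial (Fin K) ℝ) := Bst.map C with hN
  set D : Matrix (Fin (K * m)) (Fin (K * m)) (MvPolynomial (Fin K) ℝ) :=
    diagonal fun r => X (finProdFinEquiv.symm r).1 with hD
  rw [Literature.Analysis.TotalPositivity.det_mul_eq_sum_strictMono, coeff_sum]
  refine Finset.sum_nonneg fun t _ => ?_
  -- the `t`-term is `C (det Bst_t)² · ∏_i X_{l(t i)}`
  have hsub : (D * N).submatrix t id =
      diagonal (fun i => (X (finProdFinEquiv.symm (t i)).1 : MvPolynomial (Fin K) ℝ)) * N.submatrix t id := by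
    ext i j
    simp only [submatrix_apply, id, hD, diagonal_mul]
  have hNt : N.submatrix t id = (Bst.submatrix t id).map C := by
    rw [hN, submatrix_map]
  have hdet : (N.submatrix t id).det = C ((Bst.submatrix t id).det) := by
    rw [hNt]
    exact (RingHom.map_det (C : ℝ →+* MvPolynomial (Fin K) ℝ) (Bst.submatrix t id)).symm
  rw [← transpose_submatrix, det_transpose, hsub, det_mul, det_diagonal, hdet]
  have : C (Bst.submatrix t id).det *
        ((∏ i, (X (finProdFinEquiv.symm (t i)).1 : MvPolynomial (Fin K) ℝ)) * C (Bst.submatrix t id).det) =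
      C ((Bst.submatrix t id).det * (Bst.submatrix t id).det) *
        ∏ i, (X (finProdFinEquiv.symm (t i)).1 : MvPolynomial (Fin K) ℝ) := by
    rw [map_mul]; ring
  rw [this]
  exact coeff_C_mul_self_mul_prod_X_nonneg _ _ d

/-- **(a) of the line's `IsLorentzianArray` for `detArray`** — the statement the line file
`Cruxes/MatrixDescartes/Lines/lorentzian_shadow.lean` needs, with its local `detArray m K A α :=
coeff (equivFunOnFinite.symm α) (det Σ_l X_l • (A_l).map C)` UNFOLDED (the line file carries `sorry`s and is
not importable; the two agree definitionally):  for `A_l ⪰ 0` every coefficient of `det Σ_l s_l A_l` is `≥ 0`.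
[cite: BorceaBranden2009, Prop. 2.4] -/
theorem detArray_nonneg_of_posSemidef (m K : ℕ) (A : Fin K → Matrix (Fin m) (Fin m) ℝ)
    (hA : ∀ l, (A l).PosSemidef) (α : Fin K → ℕ) :
    0 ≤ MvPolynomial.coeff (Finsupp.equivFunOnFinite.symm α)
      (Matrix.det (∑ l, (MvPolynomial.X l : MvPolynomial (Fin K) ℝ) • (A l).map MvPolynomial.C)) :=
  coeff_det_pencil_nonneg A hA _


/-! ### (b) support on the layer `Δ(m,K)` — homogeneity of degree `m` (p4 g10's lemma) -/

/-- **(b) of the line's `IsLorentzianArray` for `detArray`** (the line's `layer m K` UNFOLDED): the coefficient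
array of `det Σ_l X_l • A_l` vanishes off the layer `Δ(m,K) = {α | Σ α = m}` — for ANY real `A_l`.
[folklore] -/
theorem detArray_eq_zero_of_not_mem_layer (m K : ℕ) (A : Fin K → Matrix (Fin m) (Fin m) ℝ) (α : Fin K → ℕ)
    (hα : α ∉ (Fintype.piFinset fun _ : Fin K => Finset.range (m + 1)).filter (fun α => ∑ i, α i = m)) :
    MvPolynomial.coeff (Finsupp.equivFunOnFinite.symm α)
      (Matrix.det (∑ l, (MvPolynomial.X l : MvPolynomial (Fin K) ℝ) • (A l).map MvPolynomial.C)) = 0 := by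
  classical
  apply (DetCurve.det_genericPencil_isHomogeneous A).coeff_eq_zero
  intro hdeg
  apply hα
  rw [Finsupp.degree_eq_sum] at hdeg
  simp only [Finsupp.coe_equivFunOnFinite_symm] at hdeg
  rw [Finset.mem_filter, Fintype.mem_piFinset]
  refine ⟨fun i => Finset.mem_range.2 (Nat.lt_succ_of_le ?_), hdeg⟩
  rw [← hdeg]
  exact Finset.single_le_sum (fun j _ => Nat.zero_le (α j)) (Finset.mem_univ i)

end DetLorentzian

end Summit.ValiantsHypothesis.ValiantsHypothesis.Theorems.LacunarySymmetroidMatrixDescartes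

end
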